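import Mathlib.LinearAlgebra.TensorProduct.Pi
import Mathlib.LinearAlgebra.Matrix.ToLin
import HarnessLib

/-!
# The fixed vectors of an idempotent matrix on `Mⁿ` are `M ⊗_R 𝔟` for `𝔟 = E·Rⁿ` (Serre tensor: points = tensor product)

Topic `Algebra/Module`, namespace `Literature.Algebra.Module.IdempotentMatrix` (pure Mathlib linear algebra; constructions with bodies +
proved theorems; no named fact, no `sorry`, no instance, no notation).  Cell `hodgecm-mathlib`, F0/P6 «MOD», P6a organ (g2) (Serre
tensor) support: with ★ `AbelianSchemes/SerreTensorConstruction.serreHomEquiv` («the `T`-points of `A ⊗_𝒪 𝔟 = Fix([E] ↷ Aⁿ)` are the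
tuples `x ∈ A(T)ⁿ` with `E·x = x`») this file supplies the missing algebra «`{x ∈ Mⁿ | E x = x} = M ⊗_𝒪 𝔟`» for ANY module `M` over a
commutative ring and any idempotent `E ∈ Mₙ(R)` presenting the finitely generated projective module `𝔟 = E·Rⁿ = range E`
(B. Conrad, *Gross–Zagier revisited* §7: `(M ⊗_R A)(T) = M ⊗_R A(T)` for finite projective `M`).  `--supports stmt-HodgeConjecture-24832`,
count-neutral.  HC_CM is proved only modulo the 2 remaining named inputs (hLiu418, h413) until rung 0 closes; this file discharges none.

## Mathematics

`Rⁿ = E·Rⁿ ⊕ (1 − E)·Rⁿ`, so `M ⊗_R E·Rⁿ ↪ M ⊗_R Rⁿ = Mⁿ` (Mathlib `TensorProduct.piScalarRight`) is a split injection whose image is the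
image of the idempotent `1 ⊗ E = (v ↦ E·v)` of `Mⁿ`, i.e. the fixed vectors `{v | E·v = v}`.

## Contents

* `smulVecLin E : (Fin n → M) →ₗ[R] (Fin n → M)`, `v ↦ (∑_k E_{jk} • v_k)_j` (`_apply`, `_one`, `_mul`, `_comp_self` for idempotent `E`);
* `piScalarRight_lTensor_toLin'` : `Mⁿ ≅ M ⊗ Rⁿ` intertwines `1 ⊗ E` and `smulVecLin E`;
* `fixedSubmodule E M := {v | E·v = v}` (`mem_fixedSubmodule_iff`, `smulVec_mem_fixedSubmodule`);
* **`tensorRangeEquivFixed E hE : M ⊗[R] LinearMap.range (Matrix.toLin' E) ≃ₗ[R] fixedSubmodule E M`** (`_apply_coe`, `_symm_apply`).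

## References
* [Conrad2004GrossZagier] B. Conrad, *Gross–Zagier revisited*, MSRI Publ. 49 (2004), §7 «The Serre tensor construction» (p. 98).
* [GortzWedhorn2020] Definition/Proposition B.15 (projective modules: direct summands of free modules).
* Mathlib: `LinearAlgebra.TensorProduct.Pi` (`TensorProduct.piScalarRight`), `LinearAlgebra.Matrix.ToLin` (`Matrix.toLin'`).
-/

namespace Literature.Algebra.Module.IdempotentMatrix

open TensorProduct Matrix

variable {R : Type*} [CommRing R] (M : Type*) [AddCommGroup M] [Module R M] {n : ℕ} (E F : Matrix (Fin n) (Fin n) R)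

/-- `E·v` for a matrix `E ∈ Mₙ(R)` and a vector `v ∈ Mⁿ` of MODULE elements: `(E·v)_j = ∑_k E_{jk} • v_k`, as a linear map.
[cite: Conrad2004GrossZagier, §7] -/
def smulVecLin : (Fin n → M) →ₗ[R] (Fin n → M) where
  toFun v j := ∑ k, E j k • v k
  map_add' v w := by
    funext j
    simp only [Pi.add_apply, smul_add, Finset.sum_add_distrib]
  map_smul' r v := by
    funext j
    simp only [Pi.smul_apply, RingHom.id_apply, Finset.smul_sum, smul_comm r]

/-- `(E·v)_j = ∑_k E_{jk} • v_k`. [cite: Conrad2004GrossZagier, §7] -/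
@[simp] theorem smulVecLin_apply (v : Fin n → M) (j : Fin n) : smulVecLin M E v j = ∑ k, E j k • v k := rfl

/-- `1·v = v`. [cite: Conrad2004GrossZagier, §7] -/
theorem smulVecLin_one : smulVecLin M (1 : Matrix (Fin n) (Fin n) R) = LinearMap.id := by
  refine LinearMap.ext fun v => funext fun j => ?_
  rw [smulVecLin_apply, LinearMap.id_apply, Finset.sum_eq_single j (fun k _ hkj => by rw [one_apply_ne' hkj, zero_smul])
    (fun h => absurd (Finset.mem_univ j) h), one_apply_eq, one_smul]

/-- `(E F)·v = E·(F·v)`. [cite: Conrad2004GrossZagier, §7] -/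
theorem smulVecLin_mul : smulVecLin M (E * F) = smulVecLin M E ∘ₗ smulVecLin M F := by
  ext v j
  simp only [smulVecLin_apply, LinearMap.coe_comp, Function.comp_apply, Matrix.mul_apply, Finset.sum_smul, Finset.smul_sum,
    mul_smul]
  rw [Finset.sum_comm]

variable {E} in
/-- For idempotent `E`: `E·(E·v) = E·v`. [cite: Conrad2004GrossZagier, §7] -/
theorem smulVecLin_comp_self (hE : E * E = E) : smulVecLin M E ∘ₗ smulVecLin M E = smulVecLin M E := by
  rw [← smulVecLin_mul, hE]

/-- `Mⁿ ≅ M ⊗_R Rⁿ` intertwines `smulVecLin E` and `1 ⊗ E`: `piScalarRight (1 ⊗ E) x = E·(piScalarRight x)`.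
[cite: Conrad2004GrossZagier, §7] -/
theorem piScalarRight_lTensor_toLin' (x : M ⊗[R] (Fin n → R)) :
    TensorProduct.piScalarRight R R M (Fin n) (LinearMap.lTensor M (Matrix.toLin' E) x) =
      smulVecLin M E (TensorProduct.piScalarRight R R M (Fin n) x) := by
  induction x using TensorProduct.induction_on with
  | zero => simp only [map_zero]
  | tmul m f =>
    funext j
    simp only [LinearMap.lTensor_tmul, TensorProduct.piScalarRight_apply, TensorProduct.piScalarRightHom_tmul, Matrix.toLin'_apply,
      smulVecLin_apply, Matrix.mulVec, dotProduct, Finset.sum_smul, smul_smul]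
  | add x y hx hy => simp only [map_add, hx, hy]

/-- The fixed vectors `{v ∈ Mⁿ | E·v = v}` of `E` (a submodule). [cite: Conrad2004GrossZagier, §7] -/
def fixedSubmodule : Submodule R (Fin n → M) := LinearMap.ker (smulVecLin M E - LinearMap.id)

/-- `v ∈ fixedSubmodule E M ↔ E·v = v`. [cite: Conrad2004GrossZagier, §7] -/
theorem mem_fixedSubmodule_iff (v : Fin n → M) : v ∈ fixedSubmodule M E ↔ smulVecLin M E v = v := by
  rw [fixedSubmodule, LinearMap.mem_ker, LinearMap.sub_apply, LinearMap.id_apply, sub_eq_zero]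

variable {E} in
/-- For idempotent `E`, every `E·v` is fixed. [cite: Conrad2004GrossZagier, §7] -/
theorem smulVec_mem_fixedSubmodule (hE : E * E = E) (v : Fin n → M) : smulVecLin M E v ∈ fixedSubmodule M E := by
  rw [mem_fixedSubmodule_iff, ← LinearMap.comp_apply, smulVecLin_comp_self M hE]

/-- The projection `Rⁿ → E·Rⁿ = range E`, `f ↦ E f` (Mathlib `LinearMap.rangeRestrict`). [cite: Conrad2004GrossZagier, §7] -/
def rangeProj : (Fin n → R) →ₗ[R] LinearMap.range (Matrix.toLin' E) := (Matrix.toLin' E).rangeRestrict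

variable {E} in
/-- For idempotent `E` the projection splits the inclusion: `E f = f` on `range E`. [cite: Conrad2004GrossZagier, §7] -/
theorem rangeProj_comp_subtype (hE : E * E = E) :
    rangeProj E ∘ₗ (LinearMap.range (Matrix.toLin' E)).subtype = LinearMap.id := by
  refine LinearMap.ext fun f => Subtype.ext ?_
  obtain ⟨f, g, rfl⟩ := f
  change Matrix.toLin' E (Matrix.toLin' E g) = Matrix.toLin' E g
  rw [← LinearMap.comp_apply, ← Matrix.toLin'_mul, hE]

/-- The inclusion followed by the projection is `E`: `subtype ∘ rangeProj = toLin' E`. [cite: Conrad2004GrossZagier, §7] -/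
theorem subtype_comp_rangeProj : (LinearMap.range (Matrix.toLin' E)).subtype ∘ₗ rangeProj E = Matrix.toLin' E :=
  LinearMap.subtype_comp_codRestrict _ _ _

/-- The comparison map `M ⊗ E·Rⁿ → Mⁿ` (inclusion tensored with `M`, then `M ⊗ Rⁿ ≅ Mⁿ`). [cite: Conrad2004GrossZagier, §7] -/
def tensorRangeToPi : M ⊗[R] LinearMap.range (Matrix.toLin' E) →ₗ[R] (Fin n → M) :=
  (TensorProduct.piScalarRight R R M (Fin n)).toLinearMap ∘ₗ LinearMap.lTensor M (LinearMap.range (Matrix.toLin' E)).subtype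

/-- The retraction `Mⁿ → M ⊗ E·Rⁿ` (`Mⁿ ≅ M ⊗ Rⁿ`, then the projection tensored with `M`). [cite: Conrad2004GrossZagier, §7] -/
def piToTensorRange : (Fin n → M) →ₗ[R] M ⊗[R] LinearMap.range (Matrix.toLin' E) :=
  LinearMap.lTensor M (rangeProj E) ∘ₗ (TensorProduct.piScalarRight R R M (Fin n)).symm.toLinearMap

variable {E} in
/-- `piToTensorRange ∘ tensorRangeToPi = id` (idempotent `E`). [cite: Conrad2004GrossZagier, §7] -/
theorem piToTensorRange_comp_tensorRangeToPi (hE : E * E = E) : piToTensorRange M E ∘ₗ tensorRangeToPi M E = LinearMap.id := by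
  rw [piToTensorRange, tensorRangeToPi, LinearMap.comp_assoc, ← LinearMap.comp_assoc _ (TensorProduct.piScalarRight R R M (Fin n)).toLinearMap,
    LinearEquiv.symm_comp, LinearMap.id_comp, ← LinearMap.lTensor_comp, rangeProj_comp_subtype hE, LinearMap.lTensor_id]

/-- `tensorRangeToPi ∘ piToTensorRange = smulVecLin E` (on all of `Mⁿ`). [cite: Conrad2004GrossZagier, §7] -/
theorem tensorRangeToPi_comp_piToTensorRange : tensorRangeToPi M E ∘ₗ piToTensorRange M E = smulVecLin M E := by
  rw [piToTensorRange, tensorRangeToPi, LinearMap.comp_assoc, ← LinearMap.comp_assoc _ _ (LinearMap.lTensor M _),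
    ← LinearMap.lTensor_comp, subtype_comp_rangeProj]
  ext v j
  simp only [LinearMap.coe_comp, LinearEquiv.coe_coe, Function.comp_apply, piScalarRight_lTensor_toLin', LinearEquiv.apply_symm_apply]

/-- The comparison map lands in the fixed vectors. [cite: Conrad2004GrossZagier, §7] -/
theorem tensorRangeToPi_mem_fixedSubmodule (hE : E * E = E) (x : M ⊗[R] LinearMap.range (Matrix.toLin' E)) :
    tensorRangeToPi M E x ∈ fixedSubmodule M E := by
  have h : tensorRangeToPi M E x = smulVecLin M E (tensorRangeToPi M E x) := by
    conv_lhs => rw [← LinearMap.id_apply (R := R) x, ← piToTensorRange_comp_tensorRangeToPi M hE, LinearMap.comp_apply,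
      ← LinearMap.comp_apply (tensorRangeToPi M E), tensorRangeToPi_comp_piToTensorRange]
  rw [h]
  exact smulVec_mem_fixedSubmodule M hE _

/-- **`M ⊗_R E·Rⁿ ≃ {v ∈ Mⁿ | E·v = v}`** for an idempotent `E ∈ Mₙ(R)` and any `R`-module `M`: the Serre-tensor points `= M ⊗_R 𝔟`.
[cite: Conrad2004GrossZagier, §7] -/
noncomputable def tensorRangeEquivFixed (hE : E * E = E) : M ⊗[R] LinearMap.range (Matrix.toLin' E) ≃ₗ[R] fixedSubmodule M E :=
  LinearEquiv.ofLinear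
    (LinearMap.codRestrict (fixedSubmodule M E) (tensorRangeToPi M E) (tensorRangeToPi_mem_fixedSubmodule M E hE))
    (piToTensorRange M E ∘ₗ (fixedSubmodule M E).subtype)
    (by
      refine LinearMap.ext fun v => Subtype.ext ?_
      obtain ⟨v, hv⟩ := v
      change tensorRangeToPi M E (piToTensorRange M E v) = v
      rw [← LinearMap.comp_apply, tensorRangeToPi_comp_piToTensorRange]
      exact (mem_fixedSubmodule_iff M E v).1 hv)
    (by
      rw [LinearMap.comp_assoc]
      change piToTensorRange M E ∘ₗ tensorRangeToPi M E = LinearMap.id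
      exact piToTensorRange_comp_tensorRangeToPi M hE)

/-- `tensorRangeEquivFixed (m ⊗ f) = (f_j • m)_j`. [cite: Conrad2004GrossZagier, §7] -/
theorem tensorRangeEquivFixed_tmul_coe (hE : E * E = E) (m : M) (f : LinearMap.range (Matrix.toLin' E)) :
    ((tensorRangeEquivFixed M E hE (m ⊗ₜ f) : fixedSubmodule M E) : Fin n → M) = fun j => (f : Fin n → R) j • m := by
  change tensorRangeToPi M E (m ⊗ₜ f) = _
  simp only [tensorRangeToPi, LinearMap.coe_comp, LinearEquiv.coe_coe, Function.comp_apply, LinearMap.lTensor_tmul,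
    Submodule.coe_subtype, TensorProduct.piScalarRight_apply, TensorProduct.piScalarRightHom_tmul]

/-- `tensorRangeEquivFixed⁻¹ v = piToTensorRange v` (`= Σ_j m_j ⊗ E e_j` on `v = (m_j)_j`). [cite: Conrad2004GrossZagier, §7] -/
theorem tensorRangeEquivFixed_symm_apply (hE : E * E = E) (v : fixedSubmodule M E) :
    (tensorRangeEquivFixed M E hE).symm v = piToTensorRange M E (v : Fin n → M) := rfl

end Literature.Algebra.Module.IdempotentMatrix
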